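import Summits.RiemannHypothesis.RiemannHypothesis.Theses.WeilComb
import Summits.RiemannHypothesis.RiemannHypothesis.Theorems.WeilCombCombShapePositivityStubGram
import Summits.RiemannHypothesis.RiemannHypothesis.Theorems.WeilCombCombShapePositivityStubReduction
import Summits.RiemannHypothesis.RiemannHypothesis.Theorems.WeilCombCombSubcritical
import Summits.RiemannHypothesis.RiemannHypothesis.Theorems.WeilCombCombShapeAdmissible
import Summits.RiemannHypothesis.RiemannHypothesis.Theorems.CombShapePositivity.Negative.WeilCombCombShapePositivityLoadBearing
import Literature.NumberTheory.LFunctions.WeilExplicit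
import Literature.NumberTheory.LFunctions.WeilMellinBounds

/-!
# `WeilComb.CombShapePositivity` ⟺ C⁺ (Fejér means of the comb symbol are nonnegative)
(item stmt-RiemannHypothesis-11229, route route-RiemannHypothesis-WeilComb, line `Sketch`)

Notation: `φ₀(u) = expNegInvGlue (1 - u²)`, `φ_ε(t) = ε⁻¹ φ₀(t/ε)`, `ψ_ε = φ_ε ⋆ φ̃_ε`,
`τ_x h = weilTranslate h x`, `w_ε(x) = W(τ_x ψ_ε)` (the comb symbol), `χ_θ(d) = exp(i Σ_{p∈S} θ_p v_p(d))`,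
`N = ∏_{p ∈ S} p ^ n`, and the Fejér mean (box form)
`P(ε, S, n, θ) = Σ_{d, d' ∣ N} χ_θ(d) conj χ_θ(d') w_ε(log d − log d')`.

The line `Sketch` (Bohr–Fejér composition, card `bohr-fejer-reduction`) reduces the crux to three stubs;
two are landed (`stub_gram`, the Gram identity `Q(g) = Σ a_m conj a_{m'} w_ε(log m − log m')`, and
`stub_reduction`, the product-vector reduction). This file records, kernel-checked:

* `fejer_of_cell` — each Fejér-mean inequality `0 ≤ Re P(ε, S, n, θ)` is ONE CELL of the crux: it follows
  from the level-`N` instance `∀ a, 0 ≤ Re Q(comb ε N a)` alone (evaluate on the Bohr-twisted flat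
  divisor-box vector `a = χ_θ · 1_{· ∣ N}`, Gram identity).
* `combShapePositivity_iff_fejer` — hence the remaining stub C⁺ = `∀ ε > 0, ∀ S n θ, 0 ≤ Re P` is
  EQUIVALENT to the crux (`⇐` is the line's composition, Gram identity + reduction): C⁺ is the crux in
  Bohr coordinates, exactly as hard — `fejer_of_riemannHypothesis` (RH ⇒ C⁺) and
  `fejer_iff_riemannHypothesis_of_detection` (C⁺ ⟺ RH given the support item `CombShapeDetection`).
* `fejer_subcritical` — the UNCONDITIONAL corner of C⁺: by Theorem A (`CombSubcritical`, proved in tree) there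
  is a universal `c₀ > 0` with `0 ≤ Re P(ε, S, n, θ)` whenever `ε · N ≤ c₀`.
* `combShapePositivity_iff_cofinal` — the structural reason no reshaping helps: every family of cells that is
  co-final in `M` at each `ε` is already the whole crux (level monotonicity).
-/

noncomputable section

-- the sub-problem path RiemannHypothesis/RiemannHypothesis duplicates a namespace (D-0017)
set_option linter.dupNamespace false

open scoped BigOperators ComplexConjugate
open Complex

namespace Summit.RiemannHypothesis.RiemannHypothesis.Theorems.WeilCombBohrFejer

open Literature.NumberTheory.LFunctions
open Summit.RiemannHypothesis.RiemannHypothesis.Theses.WeilComb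

/-- The divisors of `N ≠ 0` are the elements of `[1, N]` dividing `N`. [folklore] -/
private theorem divisors_eq_filter_Icc {N : ℕ} (hN : N ≠ 0) :
    N.divisors = (Finset.Icc 1 N).filter (· ∣ N) := by
  ext d
  simp only [Nat.mem_divisors, Finset.mem_filter, Finset.mem_Icc]
  constructor
  · rintro ⟨hd, -⟩
    exact ⟨⟨Nat.pos_of_dvd_of_pos hd (Nat.pos_of_ne_zero hN), Nat.le_of_dvd (Nat.pos_of_ne_zero hN) hd⟩,
      hd⟩
  · rintro ⟨-, hd⟩
    exact ⟨hd, hN⟩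

/-- **Each Fejér mean is one cell of the crux.** For `ε > 0`, a finite set of primes `S`, `n` and `θ`,
the inequality `0 ≤ Re Σ_{d,d' ∣ N} χ_θ(d) conj χ_θ(d') w_ε(log d − log d')` follows from the level-`N`
instance of the crux (`N = ∏_{p∈S} p^n`): evaluate it on the box vector `a = χ_θ · 1_{· ∣ N}` and rewrite by
the Gram identity `stub_gram`; the coefficients vanish off the divisors of `N`, which lie in `[1, N]`.
[folklore] -/
theorem fejer_of_cell {ε : ℝ} (hε : 0 < ε) {S : Finset ℕ} (hS : ∀ p ∈ S, p.Prime) (n : ℕ) (θ : ℕ → ℝ)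
    (hcell : ∀ a : ℕ → ℂ, 0 ≤ (weilQuadratic (fun x : ℝ => ∑ m ∈ Finset.Icc 1 (∏ p ∈ S, p ^ n),
        a m * ((ε : ℂ)⁻¹ * ((expNegInvGlue (1 - ((x - Real.log (m : ℝ)) / ε) ^ 2) : ℝ) : ℂ)))).re) :
    0 ≤ (∑ d ∈ (∏ p ∈ S, p ^ n).divisors, ∑ d' ∈ (∏ p ∈ S, p ^ n).divisors,
      Complex.exp (I * ((∑ p ∈ S, θ p * (d.factorization p : ℝ) : ℝ) : ℂ)) *
        conj (Complex.exp (I * ((∑ p ∈ S, θ p * (d'.factorization p : ℝ) : ℝ) : ℂ))) *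
        weilFunctional (weilTranslate
          (weilConv (fun t : ℝ => (ε : ℂ)⁻¹ * ((expNegInvGlue (1 - (t / ε) ^ 2) : ℝ) : ℂ))
            (weilReflect (fun t : ℝ => (ε : ℂ)⁻¹ * ((expNegInvGlue (1 - (t / ε) ^ 2) : ℝ) : ℂ))))
          (Real.log (d : ℝ) - Real.log (d' : ℝ)))).re := by
  set N : ℕ := ∏ p ∈ S, p ^ n with hN_def
  have hN : N ≠ 0 := Finset.prod_ne_zero_iff.mpr fun p hp => pow_ne_zero _ (hS p hp).ne_zero
  -- the comb symbol and the Bohr character, as functions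
  set W : ℕ → ℕ → ℂ := fun d d' => weilFunctional (weilTranslate
      (weilConv (fun t : ℝ => (ε : ℂ)⁻¹ * ((expNegInvGlue (1 - (t / ε) ^ 2) : ℝ) : ℂ))
        (weilReflect (fun t : ℝ => (ε : ℂ)⁻¹ * ((expNegInvGlue (1 - (t / ε) ^ 2) : ℝ) : ℂ))))
      (Real.log (d : ℝ) - Real.log (d' : ℝ))) with hW_def
  set χ : ℕ → ℂ := fun d => Complex.exp (I * ((∑ p ∈ S, θ p * (d.factorization p : ℝ) : ℝ) : ℂ))
    with hχ_def
  -- the cell on the box vector `a = χ · 1_{· ∣ N}`, rewritten by the Gram identity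
  have key := hcell (fun d => if d ∣ N then χ d else 0)
  rw [stub_gram ε hε N _] at key
  -- identify the two double sums
  have e : (∑ m ∈ Finset.Icc 1 N, ∑ m' ∈ Finset.Icc 1 N,
      (if m ∣ N then χ m else 0) * conj (if m' ∣ N then χ m' else 0) * W m m') =
      ∑ d ∈ N.divisors, ∑ d' ∈ N.divisors, χ d * conj (χ d') * W d d' := by
    rw [divisors_eq_filter_Icc hN]
    simp only [Finset.sum_filter]
    refine Finset.sum_congr rfl fun m _ => ?_
    by_cases h1 : m ∣ N
    · rw [if_pos h1, if_pos h1]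
      refine Finset.sum_congr rfl fun m' _ => ?_
      by_cases h2 : m' ∣ N
      · rw [if_pos h2, if_pos h2]
      · rw [if_neg h2, if_neg h2, map_zero, mul_zero, zero_mul]
    · rw [if_neg h1, if_neg h1]
      exact Finset.sum_eq_zero fun m' _ => by rw [zero_mul, zero_mul]
  rw [e] at key
  exact key

/-- **crux ⇒ C⁺**: every Fejér-mean inequality is a cell of the crux (`fejer_of_cell`). [folklore] -/
theorem fejer_of_combShapePositivity (h : CombShapePositivity) :
    ∀ ε : ℝ, 0 < ε → ∀ S : Finset ℕ, (∀ p ∈ S, p.Prime) → ∀ (n : ℕ) (θ : ℕ → ℝ),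
      0 ≤ (∑ d ∈ (∏ p ∈ S, p ^ n).divisors, ∑ d' ∈ (∏ p ∈ S, p ^ n).divisors,
        Complex.exp (I * ((∑ p ∈ S, θ p * (d.factorization p : ℝ) : ℝ) : ℂ)) *
          conj (Complex.exp (I * ((∑ p ∈ S, θ p * (d'.factorization p : ℝ) : ℝ) : ℂ))) *
          weilFunctional (weilTranslate
            (weilConv (fun t : ℝ => (ε : ℂ)⁻¹ * ((expNegInvGlue (1 - (t / ε) ^ 2) : ℝ) : ℂ))
              (weilReflect (fun t : ℝ => (ε : ℂ)⁻¹ * ((expNegInvGlue (1 - (t / ε) ^ 2) : ℝ) : ℂ))))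
            (Real.log (d : ℝ) - Real.log (d' : ℝ)))).re :=
  fun ε hε _ hS n θ => fejer_of_cell hε hS n θ (h ε hε _)

/-- **The remaining stub of line `Sketch` is the crux in Bohr coordinates**:
`WeilComb.CombShapePositivity ⟺ C⁺` (Fejér means of the comb symbol nonnegative on every torus `T^S`).
`⇒` is `fejer_of_combShapePositivity`; `⇐` is the composition of line `Sketch` (Gram identity `stub_gram` +
product-vector reduction `stub_reduction` applied to the comb symbol `x ↦ W(τ_x ψ_ε)`). [folklore] -/
theorem combShapePositivity_iff_fejer :
    CombShapePositivity ↔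
      ∀ ε : ℝ, 0 < ε → ∀ S : Finset ℕ, (∀ p ∈ S, p.Prime) → ∀ (n : ℕ) (θ : ℕ → ℝ),
        0 ≤ (∑ d ∈ (∏ p ∈ S, p ^ n).divisors, ∑ d' ∈ (∏ p ∈ S, p ^ n).divisors,
          Complex.exp (I * ((∑ p ∈ S, θ p * (d.factorization p : ℝ) : ℝ) : ℂ)) *
            conj (Complex.exp (I * ((∑ p ∈ S, θ p * (d'.factorization p : ℝ) : ℝ) : ℂ))) *
            weilFunctional (weilTranslate
              (weilConv (fun t : ℝ => (ε : ℂ)⁻¹ * ((expNegInvGlue (1 - (t / ε) ^ 2) : ℝ) : ℂ))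
                (weilReflect (fun t : ℝ => (ε : ℂ)⁻¹ * ((expNegInvGlue (1 - (t / ε) ^ 2) : ℝ) : ℂ))))
              (Real.log (d : ℝ) - Real.log (d' : ℝ)))).re :=
  ⟨fejer_of_combShapePositivity, fun hC ε hε M a => by
    -- `⇐` is the composition of line `Sketch`: Gram identity, then the product-vector reduction
    -- applied to the comb symbol `x ↦ W(τ_x ψ_ε)`, whose box hypothesis is `hC ε hε`
    rw [stub_gram ε hε M a]
    exact stub_reduction
      (fun x : ℝ => weilFunctional (weilTranslate
        (weilConv (fun t : ℝ => (ε : ℂ)⁻¹ * ((expNegInvGlue (1 - (t / ε) ^ 2) : ℝ) : ℂ))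
          (weilReflect (fun t : ℝ => (ε : ℂ)⁻¹ * ((expNegInvGlue (1 - (t / ε) ^ 2) : ℝ) : ℂ)))) x))
      (hC ε hε) M a⟩

/-- **RH ⇒ C⁺**: the Fejér-means statement is RH-implied (RH ⇒ crux by Weil positivity under RH,
`weilComb_not_riemannHypothesis_of_not_combShapePositivity`; crux ⇒ C⁺ above). [folklore] -/
theorem fejer_of_riemannHypothesis (hRH : RiemannHypothesis) :
    ∀ ε : ℝ, 0 < ε → ∀ S : Finset ℕ, (∀ p ∈ S, p.Prime) → ∀ (n : ℕ) (θ : ℕ → ℝ),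
      0 ≤ (∑ d ∈ (∏ p ∈ S, p ^ n).divisors, ∑ d' ∈ (∏ p ∈ S, p ^ n).divisors,
        Complex.exp (I * ((∑ p ∈ S, θ p * (d.factorization p : ℝ) : ℝ) : ℂ)) *
          conj (Complex.exp (I * ((∑ p ∈ S, θ p * (d'.factorization p : ℝ) : ℝ) : ℂ))) *
          weilFunctional (weilTranslate
            (weilConv (fun t : ℝ => (ε : ℂ)⁻¹ * ((expNegInvGlue (1 - (t / ε) ^ 2) : ℝ) : ℂ))
              (weilReflect (fun t : ℝ => (ε : ℂ)⁻¹ * ((expNegInvGlue (1 - (t / ε) ^ 2) : ℝ) : ℂ))))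
            (Real.log (d : ℝ) - Real.log (d' : ℝ)))).re :=
  fejer_of_combShapePositivity (by_contra fun h =>
    Summit.RiemannHypothesis.RiemannHypothesis.Theorems.weilComb_not_riemannHypothesis_of_not_combShapePositivity
      h hRH)

/-- **C⁺ ⟺ RH given detection**: with the route's support item `CombShapeDetection`, the remaining stub of
line `Sketch` is equivalent to the Riemann hypothesis. [folklore] -/
theorem fejer_iff_riemannHypothesis_of_detection (hDet : CombShapeDetection) :
    (∀ ε : ℝ, 0 < ε → ∀ S : Finset ℕ, (∀ p ∈ S, p.Prime) → ∀ (n : ℕ) (θ : ℕ → ℝ),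
      0 ≤ (∑ d ∈ (∏ p ∈ S, p ^ n).divisors, ∑ d' ∈ (∏ p ∈ S, p ^ n).divisors,
        Complex.exp (I * ((∑ p ∈ S, θ p * (d.factorization p : ℝ) : ℝ) : ℂ)) *
          conj (Complex.exp (I * ((∑ p ∈ S, θ p * (d'.factorization p : ℝ) : ℝ) : ℂ))) *
          weilFunctional (weilTranslate
            (weilConv (fun t : ℝ => (ε : ℂ)⁻¹ * ((expNegInvGlue (1 - (t / ε) ^ 2) : ℝ) : ℂ))
              (weilReflect (fun t : ℝ => (ε : ℂ)⁻¹ * ((expNegInvGlue (1 - (t / ε) ^ 2) : ℝ) : ℂ))))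
            (Real.log (d : ℝ) - Real.log (d' : ℝ)))).re) ↔
      RiemannHypothesis :=
  combShapePositivity_iff_fejer.symm.trans
    (Summit.RiemannHypothesis.RiemannHypothesis.Theorems.weilComb_combShapePositivity_iff_riemannHypothesis_of_detection
      hDet)

/-- **The unconditional corner of C⁺ (Theorem A in Bohr coordinates).** There is a universal `c₀ > 0` such
that the Fejér mean at `(ε, S, n, θ)` is nonnegative whenever `ε · N ≤ c₀`, `N = ∏_{p∈S} p^n`: the cell
`(ε, N)` lies in the subcritical regime of `CombSubcritical` (`WeilCombSubcritical.CombSubcritical_of`, applied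
to the fixed bump via `CombShapeAdmissible`), and `fejer_of_cell` transfers it. [folklore] -/
theorem fejer_subcritical :
    ∃ c₀ : ℝ, 0 < c₀ ∧ ∀ ε : ℝ, 0 < ε → ∀ S : Finset ℕ, (∀ p ∈ S, p.Prime) → ∀ (n : ℕ) (θ : ℕ → ℝ),
      ε * ((∏ p ∈ S, p ^ n : ℕ) : ℝ) ≤ c₀ →
      0 ≤ (∑ d ∈ (∏ p ∈ S, p ^ n).divisors, ∑ d' ∈ (∏ p ∈ S, p ^ n).divisors,
        Complex.exp (I * ((∑ p ∈ S, θ p * (d.factorization p : ℝ) : ℝ) : ℂ)) *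
          conj (Complex.exp (I * ((∑ p ∈ S, θ p * (d'.factorization p : ℝ) : ℝ) : ℂ))) *
          weilFunctional (weilTranslate
            (weilConv (fun t : ℝ => (ε : ℂ)⁻¹ * ((expNegInvGlue (1 - (t / ε) ^ 2) : ℝ) : ℂ))
              (weilReflect (fun t : ℝ => (ε : ℂ)⁻¹ * ((expNegInvGlue (1 - (t / ε) ^ 2) : ℝ) : ℂ))))
            (Real.log (d : ℝ) - Real.log (d' : ℝ)))).re := by
  obtain ⟨c₀, hc₀, hA⟩ :=
    Summit.RiemannHypothesis.RiemannHypothesis.Theorems.WeilCombSubcritical.CombSubcritical_of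
  obtain ⟨hφ, hsupp⟩ := Summit.RiemannHypothesis.RiemannHypothesis.Theorems.combShapeAdmissible_proof
  refine ⟨c₀, hc₀, fun ε hε S hS n θ hεN => fejer_of_cell hε hS n θ fun a => ?_⟩
  have h := hA (fun u : ℝ => ((expNegInvGlue (1 - u ^ 2) : ℝ) : ℂ)) hφ hsupp ε hε (∏ p ∈ S, p ^ n) a hεN
  beta_reduce at h
  exact h

/-- **Every co-final-in-`M` family of cells is the crux.** If a set of cells `P ε M` contains, for every
`ε > 0`, arbitrarily large levels `M`, then the crux is equivalent to its restriction to those cells (level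
monotonicity: extend coefficients by zero, `weilComb_shapeComb_extend`). Consequence for lines: any stub that
covers such a family is crux-equivalent; stubs that, for some `ε`, omit all large `M` cannot compose to the
crux. [folklore] -/
theorem combShapePositivity_iff_cofinal (P : ℝ → ℕ → Prop)
    (hP : ∀ ε : ℝ, 0 < ε → ∀ M₀ : ℕ, ∃ M : ℕ, M₀ ≤ M ∧ P ε M) :
    CombShapePositivity ↔ ∀ ε : ℝ, 0 < ε → ∀ M : ℕ, P ε M → ∀ a : ℕ → ℂ,
      0 ≤ (weilQuadratic (fun x : ℝ => ∑ m ∈ Finset.Icc 1 M,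
        a m * ((ε : ℂ)⁻¹ * ((expNegInvGlue (1 - ((x - Real.log (m : ℝ)) / ε) ^ 2) : ℝ) : ℂ)))).re := by
  refine ⟨fun h ε hε M _ => h ε hε M, fun h ε hε M a => ?_⟩
  obtain ⟨M', hMM', hPM'⟩ := hP ε hε M
  have key := h ε hε M' hPM' (fun m => if m ≤ M then a m else 0)
  rwa [Summit.RiemannHypothesis.RiemannHypothesis.Theorems.weilComb_shapeComb_extend hMM'] at key

end Summit.RiemannHypothesis.RiemannHypothesis.Theorems.WeilCombBohrFejer

end
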